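import Literature.NumberTheory.Transcendental.KZIntervalPeriodProofs
import Literature.NumberTheory.Transcendental.SemialgebraicLineDeriv
import Literature.NumberTheory.Transcendental.KZSemialgebraicComplex
import Mathlib.RingTheory.Algebraic.Integral

/-!
# `StokesGeneration` (stmt-KontsevichZagierPeriods-3586) — line `fibrewise_stokes`, stub `stub_rungClampedAngularCertificate`: semialgebraic toolkit

Support file for the registered rung stub R10 `stub_rungClampedAngularCertificate` (rung 4, lead
c4) of the line `fibrewise_stokes` of the crux `StokesGeneration` (route UnfoldedStokes). The
stub runs the half-angle certificate of R9 on polynomials composed with the CLAMP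
`c(z) = max a (min z b)` of a coordinate onto a sub-interval `[a, b]` with real ALGEBRAIC ends,
cut by the indicator of the open strip `{a < z < b}`. This file supplies the `ℚ`-semialgebraicity
of these atoms on a `ℚ`-semialgebraic set `s ⊆ ℝᵐ`:

* `min`/`max` of `ℚ`-semialgebraic functions (`min u v = (u + v − |u − v|)/2`,
  `max u v = (u + v + |u − v|)/2`, closure under `+, −, ·, |·|`), hence the clamp
  `x ↦ max a (min (x j) b)` (`rungClamp_sa_clamp`);
* a real polynomial with algebraic coefficients of a `ℚ`-semialgebraic function
  (`rungClamp_sa_eval_comp`: the finite sum `Σₙ qₙ φⁿ`), and the algebraicity of its value at an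
  algebraic point (`rungClamp_isAlgebraic_eval`);
* the open strip `{a < x j < b}` (`rungClamp_sa_strip`: signs of the semialgebraic functions
  `a − x j`, `x j − b`, graph elimination) and its indicator as a `ℚ`-semialgebraic function
  (`rungClamp_sa_indicator`: gluing the constants `1` and `0` along the strip).

Real-algebraic constants are `ℚ`-semialgebraic (Kontsevich–Zagier allow "algebraic" for
"rational"); the closure properties are Bochnak–Coste–Roy, Prop. 2.2.6.

References: J. Bochnak, M. Coste, M.-F. Roy, *Real Algebraic Geometry* (1998), §2.2;
M. Kontsevich, D. Zagier, *Periods* (2001), §1.1.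
-/

noncomputable section

-- `Summit.KontsevichZagierPeriods.KontsevichZagierPeriods.…` is the tree's mandated layout (single-conjunct summit).
set_option linter.dupNamespace false

namespace Summit.KontsevichZagierPeriods.KontsevichZagierPeriods.Cruxes.StokesGeneration.FibrewiseStokes

open Set
open Literature.NumberTheory.Transcendental
open Literature.ModelTheory.ExponentialFields (IsSemialgebraic)

/-! ## `min` and `max` -/

/-- `min u v = (u + v − |u − v|)/2`. [folklore] -/
theorem rungClamp_min_eq (u v : ℝ) : min u v = 2⁻¹ * (u + v - |u - v|) := by
  rcases le_total u v with h | h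
  · rw [min_eq_left h, abs_of_nonpos (sub_nonpos.mpr h)]
    ring
  · rw [min_eq_right h, abs_of_nonneg (sub_nonneg.mpr h)]
    ring

/-- `max u v = (u + v + |u − v|)/2`. [folklore] -/
theorem rungClamp_max_eq (u v : ℝ) : max u v = 2⁻¹ * (u + v + |u - v|) := by
  rcases le_total u v with h | h
  · rw [max_eq_right h, abs_of_nonpos (sub_nonpos.mpr h)]
    ring
  · rw [max_eq_left h, abs_of_nonneg (sub_nonneg.mpr h)]
    ring

/-- The pointwise `min` of two real `ℚ`-semialgebraic functions is `ℚ`-semialgebraic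
(`min u v = (u + v − |u − v|)/2` and closure under `+, −, ·, |·|`).
[cite: BochnakCosteRoy1998, Prop. 2.2.6] -/
theorem rungClamp_sa_min {m : ℕ} {s : Set (Fin m → ℝ)} {f g : (Fin m → ℝ) → ℝ}
    (hf : IsSemialgebraicFunOn ℚ s f) (hg : IsSemialgebraicFunOn ℚ s g) :
    IsSemialgebraicFunOn ℚ s (fun x => min (f x) (g x)) := by
  have hs : IsSemialgebraic ℚ s := IsSemialgebraicFunOn.isSemialgebraic_holds hf
  have h2 : IsSemialgebraicFunOn ℚ s (fun _ => (2⁻¹ : ℝ)) := by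
    simpa using isSemialgebraicFunOn_const_ratCast hs 2⁻¹
  exact (h2.fun_mul ((hf.fun_add hg).fun_sub (hf.fun_sub hg).abs)).congr
    fun x _ => (rungClamp_min_eq (f x) (g x)).symm

/-- The pointwise `max` of two real `ℚ`-semialgebraic functions is `ℚ`-semialgebraic
(`max u v = (u + v + |u − v|)/2`). [cite: BochnakCosteRoy1998, Prop. 2.2.6] -/
theorem rungClamp_sa_max {m : ℕ} {s : Set (Fin m → ℝ)} {f g : (Fin m → ℝ) → ℝ}
    (hf : IsSemialgebraicFunOn ℚ s f) (hg : IsSemialgebraicFunOn ℚ s g) :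
    IsSemialgebraicFunOn ℚ s (fun x => max (f x) (g x)) := by
  have hs : IsSemialgebraic ℚ s := IsSemialgebraicFunOn.isSemialgebraic_holds hf
  have h2 : IsSemialgebraicFunOn ℚ s (fun _ => (2⁻¹ : ℝ)) := by
    simpa using isSemialgebraicFunOn_const_ratCast hs 2⁻¹
  exact (h2.fun_mul ((hf.fun_add hg).fun_add (hf.fun_sub hg).abs)).congr
    fun x _ => (rungClamp_max_eq (f x) (g x)).symm

/-- **The clamp is semialgebraic.** For real algebraic `a`, `b`, the clamp of a coordinate onto
`[a, b]`, `x ↦ max a (min (x j) b)`, is a `ℚ`-semialgebraic function on every `ℚ`-semialgebraic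
`s ⊆ ℝᵐ` (real-algebraic constants are `ℚ`-semialgebraic, Kontsevich–Zagier 2001 §1.1).
[cite: BochnakCosteRoy1998, Prop. 2.2.6] -/
theorem rungClamp_sa_clamp {m : ℕ} {s : Set (Fin m → ℝ)} (hs : IsSemialgebraic ℚ s) {a b : ℝ}
    (ha : IsAlgebraic ℚ a) (hb : IsAlgebraic ℚ b) (j : Fin m) :
    IsSemialgebraicFunOn ℚ s (fun x => max a (min (x j) b)) :=
  rungClamp_sa_max (isSemialgebraicFunOn_const_of_isAlgebraic hs ha)
    (rungClamp_sa_min (isSemialgebraicFunOn_apply hs j) (isSemialgebraicFunOn_const_of_isAlgebraic hs hb))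

/-! ## Polynomials with algebraic coefficients -/

/-- A real polynomial with algebraic coefficients composed with a real `ℚ`-semialgebraic function
is `ℚ`-semialgebraic: `q (φ z) = Σₙ qₙ (φ z)ⁿ` is a finite sum of products of real-algebraic
constants (Kontsevich–Zagier 2001, §1.1) and powers of `φ`. [cite: BochnakCosteRoy1998, Prop. 2.2.6] -/
theorem rungClamp_sa_eval_comp {m : ℕ} {s : Set (Fin m → ℝ)} {φ : (Fin m → ℝ) → ℝ}
    (hφ : IsSemialgebraicFunOn ℚ s φ) {q : Polynomial ℝ} (hq : ∀ n, IsAlgebraic ℚ (q.coeff n)) :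
    IsSemialgebraicFunOn ℚ s (fun z => q.eval (φ z)) := by
  -- adapted from `isSemialgebraicFunOn_eval_apply` (stub R5 of this line)
  have hs : IsSemialgebraic ℚ s := IsSemialgebraicFunOn.isSemialgebraic_holds hφ
  have h : IsSemialgebraicFunOn ℚ s (fun z => ∑ n ∈ q.support, q.coeff n * (φ z) ^ n) :=
    IsSemialgebraicFunOn.fun_finsetSum _ hs fun n _ =>
      (isSemialgebraicFunOn_const_of_isAlgebraic hs (hq n)).fun_mul (hφ.fun_pow n)
  refine h.congr fun z _ => ?_
  rw [Polynomial.eval_eq_sum, Polynomial.sum_def]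

/-- The value of a real polynomial with algebraic coefficients at a real algebraic point is
algebraic (the real algebraic numbers form a subfield). [folklore] -/
theorem rungClamp_isAlgebraic_eval (f : Polynomial ℝ) (hf : ∀ n, IsAlgebraic ℚ (f.coeff n))
    {t : ℝ} (ht : IsAlgebraic ℚ t) : IsAlgebraic ℚ (f.eval t) := by
  rw [Polynomial.eval_eq_sum_range]
  exact mem_algebraicClosure_iff.mp (sum_mem fun n _ => mul_mem (mem_algebraicClosure_iff.mpr (hf n))
    (pow_mem (mem_algebraicClosure_iff.mpr ht) n))

/-! ## The open strip and its indicator -/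

/-- The open strip `{a < x j < b}` is `ℚ`-semialgebraic for real algebraic `a`, `b`: it is cut out
of `ℝᵐ` by the signs of the `ℚ`-semialgebraic functions `a − x j` and `x j − b` (graph
elimination). [cite: BochnakCosteRoy1998, §2.2] -/
theorem rungClamp_sa_strip {m : ℕ} {a b : ℝ} (ha : IsAlgebraic ℚ a) (hb : IsAlgebraic ℚ b)
    (j : Fin m) : IsSemialgebraic ℚ {x : Fin m → ℝ | a < x j ∧ x j < b} := by
  have hU : IsSemialgebraic ℚ (Set.univ : Set (Fin m → ℝ)) :=
    Literature.ModelTheory.ExponentialFields.isSemialgebraic_univ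
  have hxj : IsSemialgebraicFunOn ℚ (Set.univ : Set (Fin m → ℝ)) (fun x => x j) :=
    isSemialgebraicFunOn_apply hU j
  have h1 := ((isSemialgebraicFunOn_const_of_isAlgebraic hU ha).fun_sub hxj).isSemialgebraic_sep_neg
  have h2 := (hxj.fun_sub (isSemialgebraicFunOn_const_of_isAlgebraic hU hb)).isSemialgebraic_sep_neg
  convert h1.inter h2 using 1
  ext x
  simp only [mem_setOf_eq, mem_inter_iff, mem_univ, true_and, sub_neg]

/-- **The indicator of the open strip is semialgebraic.** For real algebraic `a`, `b`, the function
`x ↦ 1_{(a,b)}(x j)` (value `1` on the strip `{a < x j < b}`, `0` off it) is `ℚ`-semialgebraic on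
every `ℚ`-semialgebraic `s ⊆ ℝᵐ`: glue the constants `1` on `s ∩ strip` and `0` on `s ∖ strip`.
[cite: BochnakCosteRoy1998, Def. 2.2.5] -/
theorem rungClamp_sa_indicator :
    ∀ {m : ℕ} {s : Set (Fin m → ℝ)}, IsSemialgebraic ℚ s → ∀ {a b : ℝ}, IsAlgebraic ℚ a → IsAlgebraic ℚ b →
      ∀ (j : Fin m), IsSemialgebraicFunOn ℚ s (fun x => if a < x j ∧ x j < b then (1:ℝ) else 0) := by
  intro m s hs a b ha hb j
  have hstrip : IsSemialgebraic ℚ {x : Fin m → ℝ | a < x j ∧ x j < b} := rungClamp_sa_strip ha hb j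
  rw [← Set.inter_union_sdiff s {x : Fin m → ℝ | a < x j ∧ x j < b}]
  refine IsSemialgebraicFunOn.union
    (isSemialgebraicFunOn_const_of_isAlgebraic (hs.inter hstrip) isAlgebraic_one)
    (isSemialgebraicFunOn_const_of_isAlgebraic (hs.diff hstrip) isAlgebraic_zero) ?_ ?_
  · intro x hx
    exact if_pos hx.2
  · intro x hx
    exact if_neg hx.2

end Summit.KontsevichZagierPeriods.KontsevichZagierPeriods.Cruxes.StokesGeneration.FibrewiseStokes
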